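import Summits.BirchSwinnertonDyer.BirchSwinnertonDyer.Theorems.ResidualThetaTransportAtTwoThetaLayerLambdaCongruenceAtTwoManinSystemFactor
import Summits.BirchSwinnertonDyer.BirchSwinnertonDyer.Theorems.ResidualThetaTransportAtTwoThetaLayerLambdaCongruenceAtTwoParabolicCharacterFactor
import Summits.BirchSwinnertonDyer.Rank1Residual.ManinAdditive.ShimuraIndexFrickeLaw
import Summits.BirchSwinnertonDyer.BirchSwinnertonDyer.Theorems.ManinLocalTwoThreeShimuraClasses
import Summits.BirchSwinnertonDyer.BirchSwinnertonDyer.Theorems.ResidualThetaTransportAtTwoThetaLayerLambdaCongruenceAtTwoDualChainAcyclic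
import Summits.BirchSwinnertonDyer.Rank2.LevelFifteenEisensteinPeriod
import Literature.NumberTheory.EllipticCurves.ModularCurveEtaProductsProofs
import Literature.NumberTheory.EllipticCurves.ManinConstantGamma1ModularDegree
import HarnessLib

/-!
# C3 `ManinPrimeToThreeAtNine` helper (es g45, T-es-103, part 1 of 3: §1–§2; §3 = `…ShimuraClassThreeLift`, §4–§6 = `…ShimuraClassThreeDescent`) — THE `3`-PRIMARY SHIMURA CLASS AT THE ADDITIVE LEVEL `27`:
# `3 ∣ [Λ(f) : Λ₁(f)]` and `¬ ShimuraIndexPrimeTo 3 f` for every non-zero `f ∈ S₂(Γ₀(27))`, FACT-FREE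

HONEST FRAMING. Printed mathematics (Ling–Oesterlé 1991, Thm. 1: the Shimura subgroup `Σ(27)` of `J₀(27)` has order
`3`; Mazur 1977 §II.11; Stevens 1982 Ch. 1), new formal proof. Beyond-print theorem: NO. Nothing about any elliptic
curve is asserted; the Manin conjecture `c = 1`, C2, C3 and BSD stay OPEN. This file is a NEGATIVE DATUM for the C3
domain `27 ∣ N`: the Shimura-index hypothesis `ShimuraIndexPrimeTo 3 D.f` FAILS at `N = 27` for EVERY `X₀(27)`-datum
(so no C3 closer may assume it there), in the currency of the route's own predicate.

THE OBSTACLE AND THE TRICK. The landed factorisation `exists_addMonoidHom_periodHomology_of_maninSystem` (route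
ResidualThetaTransportAtTwo, fact-free) turns a left-`Γ₀(N)`-invariant MANIN SYSTEM `M` on `Γ₀(N)\SL₂(ℤ)` with values
in `R` into an additive map `H₁(X₀(N), ℤ) = periodHomology N →+ R` — but only for `R` WITHOUT `3`-TORSION (its torsion
lemma divides by `3` once). The cubic Shimura character `χ : (ℤ/27)ˣ → (ℤ/9)ˣ → ℤ/3` (`χ = log₂ mod 3`, `chi27`)
lives in `R = ℤ/3`. We therefore LIFT: the `ℤ/3`-valued Shimura Manin system `MS_χ(h) = F_χ(h) − F_χ(hS)` of the
cusp function `F_χ` (`cuspFun`; `colFun (a, c) = ψ(c)` off the fibre `9 ∣ c`, `−χ(a)` on it, `ψ(c) = χ(c)` for units,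
`χ(c/3)` for `3 ∥ c`) admits an INTEGRAL LIFT `M̃ : Γ₀(27)\SL₂(ℤ) → ℤ` (`rowFun`, two explicit tables `liftA`, `liftB`
on `P¹(ℤ/27)` with values in `{−2,…,2}`, found by integer elimination on Manin's `18` two-term and `12` three-term
relations at level `27`) that satisfies the two- and three-term relations OVER `ℤ` (`rowFun_S`, `rowFun_three_term`,
kernel-checked by `decide` on `(ℤ/27)²`) and reduces to `MS_χ` mod `3` (`maninInt_cast`). Apply the landed theorem
with `R = ℤ` (no `3`-torsion; `S`- and `TS`-fixed cosets are handled by `2M̃ = 0 ⇒ M̃ = 0`, `3M̃ = 0 ⇒ M̃ = 0` in `ℤ`),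
compose with `ℤ → ℤ/3`, and identify the chain sums with the telescoping sums of `F_χ`: the result is the cubic
SHIMURA COVERING CLASS `φ : periodHomology 27 →+ ℤ/3`, `φ({∞, k∞}) = χ(d_k)` (`exists_shimuraHom_twentySeven`).
Since `dim S₂(Γ₀(27)) = 1` (`finrank_cuspForm_two_eq_genusX0_twentySeven`, a theorem), `φ` descends to `Λ(f)` for
every `f ≠ 0`, kills `Λ₁(f)`, and is `χ(2) = 1 ≠ 0` on `{∞, γ₂∞}_f`, `γ₂ = (14 1; 27 2)`:
`n·{∞, γ₂∞}_f ∉ Λ₁(f)` for `3 ∤ n` (`zsmul_cuspSymbol_gammaTwo_not_mem_twentySeven`), while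
`3·{∞, γ₂∞}_f = {∞, γ₂³∞}_f ∈ Λ₁(f)` (`three_mul_cuspSymbol_gammaTwo_mem_twentySeven`: `d_{γ₂³} ≡ 8 ≡ −19` and
`19 = d_P` for the PARABOLIC `P = (−17 6; −54 19) ∈ Γ₀(27)` fixing the cusp `1/3`, whose period vanishes by the
landed `periodFunctional_eq_zero_of_conj_upper`). Hence the class of `{∞, γ₂∞}_f` in `Λ(f)/Λ₁(f)` has order EXACTLY
`3`, `Λ(f) ≠ Λ₁(f)`, and `¬ ShimuraIndexPrimeTo 3 f` (`not_shimuraIndexPrimeTo_three_twentySeven`) — E15 row `27a1`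
(index `3`, `snf [3,1]`) as a theorem for all `f ≠ 0`.

References: [LingOesterle1991] Thm. 1 and §1; [Mazur1977] §II.11; [Stevens1982] Ch. 1; [Manin1972] Thm. 1.6,
Thm. 1.9; [CremonaAlgorithms1997] §2.1–2.2.
-/

set_option autoImplicit false

noncomputable section

-- justification: the `Summit.BirchSwinnertonDyer.BirchSwinnertonDyer.…` path repeats a component (route-file convention)
set_option linter.dupNamespace false

open scoped Classical MatrixGroups

open CongruenceSubgroup Matrix.SpecialLinearGroup ModularGroup
open Literature.NumberTheory.EllipticCurves.ModularForms
open Summit.BirchSwinnertonDyer.BirchSwinnertonDyer.Theorems.ThetaLayerLambdaCongruenceAtTwo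
open Summit.BirchSwinnertonDyer.Rank1Residual.ManinAdditive.KatoCurve (ShimuraIndexPrimeTo)

namespace Summit.BirchSwinnertonDyer.BirchSwinnertonDyer.Theorems.ManinLocalTwoThree.ShimuraThree

/-! ## §1. Tables on `ℤ/27`: the cubic character `χ`, the cusp character `ψ`, inverses -/

/-- `χ(x) = log₂(x mod 9) mod 3` on units (`2 ↦ 1`, `4 ↦ 2`, `8 ↦ 0`, `7 ↦ 1`, `5 ↦ 2`, `1 ↦ 0` mod `9`), `0` on
non-units: the cubic character of `(ℤ/27)ˣ` (it factors through `(ℤ/9)ˣ`). [folklore] -/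
def chi27 (x : ZMod 27) : ZMod 3 :=
  match x.val with
  | 2 => 1 | 4 => 2 | 5 => 2 | 7 => 1 | 11 => 1 | 13 => 2 | 14 => 2 | 16 => 1 | 20 => 1
  | 22 => 2 | 23 => 2 | 25 => 1
  | _ => 0

/-- The cusp character `ψ` on `ℤ/27` off the fibre `9 ∣ c`: `ψ(c) = χ(c)` for units, `ψ(c) = χ(c/3)` for `3 ∥ c`.
[folklore] -/
def psi27 (x : ZMod 27) : ZMod 3 :=
  match x.val with
  | 2 => 1 | 4 => 2 | 5 => 2 | 6 => 1 | 7 => 1 | 11 => 1 | 12 => 2 | 13 => 2 | 14 => 2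
  | 15 => 2 | 16 => 1 | 20 => 1 | 21 => 1 | 22 => 2 | 23 => 2 | 25 => 1
  | _ => 0

/-- Inverses of units in `ℤ/27` (`0` on non-units). [folklore] -/
def inv27 (x : ZMod 27) : ZMod 27 :=
  match x.val with
  | 1 => 1 | 2 => 14 | 4 => 7 | 5 => 11 | 7 => 4 | 8 => 17 | 10 => 19 | 11 => 5 | 13 => 25
  | 14 => 2 | 16 => 22 | 17 => 8 | 19 => 10 | 20 => 23 | 22 => 16 | 23 => 20 | 25 => 13 | 26 => 26
  | _ => 0

/-- `χ(1) = 0`. [folklore] -/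
@[simp] theorem chi27_one : chi27 1 = 0 := by decide

/-- `χ(2) = 1`. [folklore] -/
theorem chi27_two : chi27 2 = 1 := by decide

/-- `a d = 1 ⇒ a = d⁻¹` (table) and `3 ∤ d`. [folklore] -/
theorem eq_inv27_of_mul_eq_one (a d : ZMod 27) (h : a * d = 1) : a = inv27 d ∧ d.val % 3 ≠ 0 := by
  revert a d; decide

/-- `d · d⁻¹ = 1` for `3 ∤ d`. [folklore] -/
theorem mul_inv27 (d : ZMod 27) (hd : d.val % 3 ≠ 0) : d * inv27 d = 1 := by
  revert d; decide

/-- `(e x)⁻¹ = e⁻¹ x⁻¹`. [folklore] -/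
theorem inv27_mul (e x : ZMod 27) : inv27 (e * x) = inv27 e * inv27 x := by
  revert e x; decide

/-- Multiplying by a unit preserves `3 ∣ ·`. [folklore] -/
theorem mul_val_mod_three (e x : ZMod 27) (he : e.val % 3 ≠ 0) : (e * x).val % 3 = 0 ↔ x.val % 3 = 0 := by
  revert e x; decide

/-- `χ` factors through `ℤ/9`: adding a multiple of `9` does not change it. [folklore] -/
theorem chi27_add_of_nine_dvd (x y : ZMod 27) (hy : y.val % 9 = 0) : chi27 (x + y) = chi27 x := by
  revert x y; decide

/-- `χ(d⁻¹ p) + χ(d) = χ(p)` (`χ` is a homomorphism on units). [folklore] -/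
theorem chi27_inv_mul (d p : ZMod 27) (hd : d.val % 3 ≠ 0) (hp : p.val % 3 ≠ 0) :
    chi27 (inv27 d * p) + chi27 d = chi27 p := by
  revert d p; decide

/-- `ψ(d q) = ψ(q) + χ(d)` for a unit `d` and `9 ∤ q` (the cusp of `X₁(27)` over a width-`< 27` cusp of `X₀(27)`
moves by `χ(d)`). [folklore] -/
theorem psi27_mul (d q : ZMod 27) (hd : d.val % 3 ≠ 0) (hq : q.val % 9 ≠ 0) : psi27 (d * q) = psi27 q + chi27 d := by
  revert d q; decide

/-- Units preserve the fibre `9 ∣ q` and its complement. [folklore] -/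
theorem mul_val_mod_nine (d q : ZMod 27) (hd : d.val % 3 ≠ 0) : (d * q).val % 9 = 0 ↔ q.val % 9 = 0 := by
  revert d q; decide

/-- `9 ∣ q ⇒ 9 ∣ b q`. [folklore] -/
theorem mul_val_mod_nine_of (b q : ZMod 27) (hq : q.val % 9 = 0) : (b * q).val % 9 = 0 := by
  revert b q; decide

/-! ## §2. The cubic Shimura cusp function on `SL₂(ℤ)` -/

/-- The cusp function on first columns `(p, q)` mod `27`: `ψ(q)` off the fibre `9 ∣ q`, `−χ(p)` on it. [folklore] -/
def colFun (p q : ZMod 27) : ZMod 3 := if q.val % 9 = 0 then -chi27 p else psi27 q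

/-- `colFun` is even. [folklore] -/
theorem colFun_neg (p q : ZMod 27) : colFun (-p) (-q) = colFun p q := by
  revert p q; decide

/-- `colFun (1, 0) = −χ(1) = 0`. [folklore] -/
theorem colFun_one_zero : colFun 1 0 = 0 := by decide

/-- **Left `Γ₀(27)`-equivariance on first columns**: for `δ = (a b; c d)` with `c ≡ 0`, `ad ≡ 1 (mod 27)`, and a
column `(p, q)` primitive at `3`, `colFun(δ·(p,q)) = colFun(p,q) + χ(d)`. [folklore] -/
theorem colFun_gamma0 (a b d p q : ZMod 27) (had : a * d = 1) (hpq : p.val % 3 ≠ 0 ∨ q.val % 3 ≠ 0) :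
    colFun (a * p + b * q) (d * q) = colFun p q + chi27 d := by
  obtain ⟨rfl, hd⟩ := eq_inv27_of_mul_eq_one a d had
  by_cases hq : q.val % 9 = 0
  · have hp : p.val % 3 ≠ 0 := hpq.resolve_right (fun h ↦ h (by omega))
    have hdq : (d * q).val % 9 = 0 := (mul_val_mod_nine d q hd).mpr hq
    simp only [colFun, hq, hdq, if_true, chi27_add_of_nine_dvd _ _ (mul_val_mod_nine_of b q hq)]
    linear_combination (-1 : ZMod 3) * chi27_inv_mul d p hd hp
  · have hdq : (d * q).val % 9 ≠ 0 := fun h ↦ hq ((mul_val_mod_nine d q hd).mp h)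
    simp only [colFun, hq, hdq, if_false, psi27_mul d q hd hq]

/-- **The cubic Shimura cusp function** `g ↦ colFun(g₀₀, g₁₀)` on `SL₂(ℤ)`. [folklore] -/
def cuspFun (g : SL(2, ℤ)) : ZMod 3 := colFun (((g 0 0 : ℤ) : ZMod 27)) (((g 1 0 : ℤ) : ZMod 27))

/-- `cuspFun` only sees the first column. [folklore] -/
theorem cuspFun_congr {g h : SL(2, ℤ)} (h0 : g 0 0 = h 0 0) (h1 : g 1 0 = h 1 0) : cuspFun g = cuspFun h := by
  simp only [cuspFun, h0, h1]

/-- Right `T`-invariance. [folklore] -/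
theorem cuspFun_mul_T (g : SL(2, ℤ)) : cuspFun (g * T) = cuspFun g := by
  apply cuspFun_congr <;> simp [_root_.Summit.BirchSwinnertonDyer.Rank2.LevelFifteen.sl_mul_apply', coe_T]

/-- Sign invariance. [folklore] -/
theorem cuspFun_neg (g : SL(2, ℤ)) : cuspFun (-g) = cuspFun g := by
  have e0 : (-g) 0 0 = -g 0 0 := by simp
  have e1 : (-g) 1 0 = -g 1 0 := by simp
  simp only [cuspFun, e0, e1, Int.cast_neg, colFun_neg]

/-- `3 ∣` the residue mod `27` iff `3 ∣` the integer. [folklore] -/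
theorem val_mod_three_eq_zero_iff (x : ℤ) : ((x : ZMod 27)).val % 3 = 0 ↔ (3 : ℤ) ∣ x := by
  have hv : ((((x : ZMod 27)).val : ℕ) : ℤ) = x % 27 := ZMod.val_intCast x
  omega

/-- `x u + y v = 1 ⇒ (x, y)` is primitive at `3` (mod `27`). [folklore] -/
theorem prim_of_eq_one (x y u v : ℤ) (h : x * u + y * v = 1) :
    ((x : ZMod 27)).val % 3 ≠ 0 ∨ ((y : ZMod 27)).val % 3 ≠ 0 := by
  by_contra hc
  rw [not_or, not_not, not_not, val_mod_three_eq_zero_iff, val_mod_three_eq_zero_iff] at hc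
  have hx : ((x : ZMod 3)) = 0 := (ZMod.intCast_zmod_eq_zero_iff_dvd x 3).mpr hc.1
  have hy : ((y : ZMod 3)) = 0 := (ZMod.intCast_zmod_eq_zero_iff_dvd y 3).mpr hc.2
  have := congrArg (Int.cast : ℤ → ZMod 3) h
  push_cast at this
  rw [hx, hy, zero_mul, zero_mul, zero_add] at this
  revert this; decide

/-- The first column of `g ∈ SL₂(ℤ)` is primitive at `3`. [folklore] -/
theorem col_prim (g : SL(2, ℤ)) : (((g 0 0 : ℤ) : ZMod 27)).val % 3 ≠ 0 ∨ (((g 1 0 : ℤ) : ZMod 27)).val % 3 ≠ 0 :=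
  prim_of_eq_one _ _ (g 1 1) (-(g 0 1)) (by linear_combination _root_.Summit.BirchSwinnertonDyer.BirchSwinnertonDyer.Theorems.ManinLocalTwoThree.ShimuraClass.sl_det g)

/-- The bottom row of `g ∈ SL₂(ℤ)` is primitive at `3`. [folklore] -/
theorem row_prim (g : SL(2, ℤ)) : (((g 1 0 : ℤ) : ZMod 27)).val % 3 ≠ 0 ∨ (((g 1 1 : ℤ) : ZMod 27)).val % 3 ≠ 0 :=
  prim_of_eq_one _ _ (-(g 0 1)) (g 0 0) (by linear_combination _root_.Summit.BirchSwinnertonDyer.BirchSwinnertonDyer.Theorems.ManinLocalTwoThree.ShimuraClass.sl_det g)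

/-- For `δ ∈ Γ₀(27)`: `δ₁₀ ≡ 0` and `δ₀₀ δ₁₁ ≡ 1 (mod 27)`. [folklore] -/
theorem gamma0_entries (δ : Gamma0 27) :
    ((((δ : SL(2, ℤ)) 1 0 : ℤ) : ZMod 27)) = 0 ∧
      ((((δ : SL(2, ℤ)) 0 0 : ℤ) : ZMod 27)) * ((((δ : SL(2, ℤ)) 1 1 : ℤ) : ZMod 27)) = 1 := by
  have hc : ((((δ : SL(2, ℤ)) 1 0 : ℤ) : ZMod 27)) = 0 := by exact_mod_cast Gamma0_mem.mp δ.2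
  refine ⟨hc, ?_⟩
  have := congrArg (Int.cast : ℤ → ZMod 27) (_root_.Summit.BirchSwinnertonDyer.BirchSwinnertonDyer.Theorems.ManinLocalTwoThree.ShimuraClass.sl_det (δ : SL(2, ℤ)))
  push_cast at this
  rw [hc, mul_zero, sub_zero] at this
  exact this

/-- **Left `Γ₀(27)`-equivariance**: `cuspFun(δg) = cuspFun(g) + χ(d_δ)`. [folklore] -/
theorem cuspFun_gamma0_mul (δ : Gamma0 27) (g : SL(2, ℤ)) :
    cuspFun ((δ : SL(2, ℤ)) * g) = cuspFun g + chi27 ((((δ : SL(2, ℤ)) 1 1 : ℤ) : ZMod 27)) := by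
  obtain ⟨hc, had⟩ := gamma0_entries δ
  have e0 : (((((δ : SL(2, ℤ)) * g) 0 0 : ℤ) : ZMod 27)) =
      ((((δ : SL(2, ℤ)) 0 0 : ℤ) : ZMod 27)) * (((g 0 0 : ℤ) : ZMod 27)) +
        ((((δ : SL(2, ℤ)) 0 1 : ℤ) : ZMod 27)) * (((g 1 0 : ℤ) : ZMod 27)) := by
    rw [_root_.Summit.BirchSwinnertonDyer.Rank2.LevelFifteen.sl_mul_apply']; push_cast; ring
  have e1 : (((((δ : SL(2, ℤ)) * g) 1 0 : ℤ) : ZMod 27)) =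
      ((((δ : SL(2, ℤ)) 1 1 : ℤ) : ZMod 27)) * (((g 1 0 : ℤ) : ZMod 27)) := by
    rw [_root_.Summit.BirchSwinnertonDyer.Rank2.LevelFifteen.sl_mul_apply']; push_cast; rw [hc, zero_mul, zero_add]
  rw [cuspFun, e0, e1, cuspFun]
  exact colFun_gamma0 _ _ _ _ _ had (col_prim g)

/-- `cuspFun 1 = 0`. [folklore] -/
@[simp] theorem cuspFun_one : cuspFun 1 = 0 := by
  have e0 : ((1 : SL(2, ℤ)) 0 0 : ℤ) = 1 := rfl
  have e1 : ((1 : SL(2, ℤ)) 1 0 : ℤ) = 0 := rfl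
  rw [cuspFun, e0, e1, Int.cast_one, Int.cast_zero]
  exact colFun_one_zero

/-- On `Γ₀(27)`: `cuspFun k = χ(d_k)`. [folklore] -/
theorem cuspFun_gamma0 (k : Gamma0 27) : cuspFun (k : SL(2, ℤ)) = chi27 ((((k : SL(2, ℤ)) 1 1 : ℤ) : ZMod 27)) := by
  have := cuspFun_gamma0_mul k 1
  rwa [mul_one, cuspFun_one, zero_add] at this


end Summit.BirchSwinnertonDyer.BirchSwinnertonDyer.Theorems.ManinLocalTwoThree.ShimuraThree
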